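import Mathlib
import Summits.NavierStokesRegularity.NavierStokesRegularity.Theorems.FilamentSkeletonRssDefectColumnGateAzimuthalBlockPrelim
import Summits.NavierStokesRegularity.NavierStokesRegularity.Theorems.FilamentSkeletonRssDefectColumnGateAxialMaxPrinciple

/-!
# Route `FilamentSkeletonRss` · cruxes `TransverseReduction1AL` (stmt-NavierStokesRegularity-23297) / `TransverseReduction1AR` (stmt-23611) ·
# registered stub S2a-loc `WaistColumnGateLoc1A` — the azimuthal blocks `|m| ≥ 3` FOR AXIALLY DEPENDENT PERTURBATIONS

Helper file (theorems only, def-free; `--supports stmt-NavierStokesRegularity-23297 --as helper`; hand leafhand-ns-filamentskeletonrs-13 g0).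

WHAT.  The s2aloc brick `azimuthalBlock_apriori_sq` (`Theorems/…AzimuthalBlock.lean`, p671383: `(1+u)⁴(a²+b²) ≤ (16(2+13/γ+γ/13)²/γ)²M²` for the
`|m| ≥ 3` blocks of the symmetric column, any real potential `V`, uniformly in the support radius) is stated for profiles that do NOT depend on the
axial station `τ`.  The registered stub lets `W` depend on `τ`; by `colForceVort_eq` the mode equations then carry the axial terms `κ'τ∂_τ − ∂_τ²`
(`κ' = B d·d ≥ 3/2 + δ > 0`), which have no gap of their own (`Theorems/…AxialNeutralModes.lean`, p827006).  THIS FILE lifts the brick to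
τ-DEPENDENT modes `a(τ,u) + i b(τ,u)` with the SAME hypotheses at every station plus `C²`-dependence on `τ`, joint continuity and boundedness on
`ℝ × [0,U]`:  **`azimuthalBlock_apriori_sq_axial`** — `(1+u)⁴(a² + b²) ≤ 4·(16(2+13/γ+γ/13)²/γ)²·M²` for all `τ` and all `u ≥ 0`, uniformly in
`U`, `V`, `m² ≥ 9`, `κ' ≥ 0` and WITHOUT any axial localisation or decay (the factor 4 pays for a quantitative margin in the maximum principle).
HOW.  The LEAD/s2aloc Wronskian argument verbatim in `u`, run through the joint maximum principle `maxPrinciple_axial_slow` (p827191) with the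
log-log penaliser: at the penalised critical point the axial terms enter the data slot as `−[a(κ'τa_τ − a_ττ) + b(κ'τb_τ − b_ττ)] ≤ δ/(2(u+κ)⁴)`
(the computation of `axial_modulus_lower`, p827220, inlined; the transport part has the good sign), and `δ = γε/8` is absorbed by the margin `γ v/8` above the threshold
`4K₀ + ε`; `ε ↓ 0` at the end.
HONEST FRAMING: an a-priori bound for ONE family of blocks of ONE linear MODEL operator of a hypothetical filament-type blow-up route (MODEL rung,
negative side); the Biot–Savart coupling, `m ∈ {0, ±1, ±2}`, strain asymmetry / tilt and the θ-synthesis are not touched; `WaistColumnGateLoc1A`,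
`TransverseReduction1AL/1AR` are neither proved nor refuted; nothing here bears on Navier–Stokes regularity.
-/

set_option linter.dupNamespace false

noncomputable section

namespace Summit.NavierStokesRegularity.NavierStokesRegularity.Theorems.DefectColumnGate

open scoped Topology
open Set Filter

set_option maxHeartbeats 6000000 in
/-- **Azimuthal blocks `|m| ≥ 3` with axial dependence — squared form.**  Data: `a b : ℝ → ℝ → ℝ` (station `τ`, sectional variable `u = r²`),
jointly continuous and bounded on `ℝ × [0,U]`, `a(τ,0) = b(τ,0) = 0`, `u`-derivatives `a₁, b₁` on `(0,∞)`, `τ`-derivatives `aτ, bτ` and second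
`τ`-derivatives `aττ, bττ` at interior `u`; at every station the block
`(4u a₁ + γu a)′ = (m²/u) a − V b − F₁ + (κ'τ·aτ − aττ)`, `(4u b₁ + γu b)′ = (m²/u) b + V a − F₂ + (κ'τ·bτ − bττ)` (′ = d/du) with ANY real
`V(τ,u)`, `κ' ≥ 0`; data `(1+u)²|F_i| ≤ M`; support `a = b = 0` on `u ≥ U`; `m² ≥ 9`.  Conclusion: `(1+u)⁴(a² + b²) ≤ 4(16(2+13/γ+γ/13)²/γ)²M²`
for every `τ` and every `u ≥ 0`. -/
theorem azimuthalBlock_apriori_sq_axial {γ m U M κ' : ℝ} {a b a₁ b₁ aτ bτ aττ bττ F₁ F₂ V : ℝ → ℝ → ℝ}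
    (hγ : 0 < γ) (hm : 9 ≤ m ^ 2) (hκ' : 0 ≤ κ')
    (hca : ContinuousOn (fun q : ℝ × ℝ => a q.1 q.2) (univ ×ˢ Icc 0 U))
    (hcb : ContinuousOn (fun q : ℝ × ℝ => b q.1 q.2) (univ ×ˢ Icc 0 U))
    (hbdd : ∃ B : ℝ, ∀ τ, ∀ u ∈ Icc 0 U, |a τ u| ≤ B ∧ |b τ u| ≤ B)
    (ha0 : ∀ τ, a τ 0 = 0) (hb0 : ∀ τ, b τ 0 = 0)
    (hdera : ∀ τ u, 0 < u → HasDerivAt (a τ) (a₁ τ u) u) (hderb : ∀ τ u, 0 < u → HasDerivAt (b τ) (b₁ τ u) u)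
    (hdaτ : ∀ u ∈ Ioo 0 U, ∀ τ, HasDerivAt (fun σ => a σ u) (aτ τ u) τ)
    (hdaττ : ∀ u ∈ Ioo 0 U, ∀ τ, HasDerivAt (fun σ => aτ σ u) (aττ τ u) τ)
    (hdbτ : ∀ u ∈ Ioo 0 U, ∀ τ, HasDerivAt (fun σ => b σ u) (bτ τ u) τ)
    (hdbττ : ∀ u ∈ Ioo 0 U, ∀ τ, HasDerivAt (fun σ => bτ σ u) (bττ τ u) τ)
    (hΦa : ∀ τ u, 0 < u → HasDerivAt (fun s => 4 * s * a₁ τ s + γ * s * a τ s)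
      (m ^ 2 / u * a τ u - V τ u * b τ u - F₁ τ u + (κ' * τ * aτ τ u - aττ τ u)) u)
    (hΦb : ∀ τ u, 0 < u → HasDerivAt (fun s => 4 * s * b₁ τ s + γ * s * b τ s)
      (m ^ 2 / u * b τ u + V τ u * a τ u - F₂ τ u + (κ' * τ * bτ τ u - bττ τ u)) u)
    (hF₁ : ∀ τ u, 0 < u → (1 + u) ^ 2 * |F₁ τ u| ≤ M) (hF₂ : ∀ τ u, 0 < u → (1 + u) ^ 2 * |F₂ τ u| ≤ M)
    (hsuppa : ∀ τ u, U ≤ u → a τ u = 0) (hsuppb : ∀ τ u, U ≤ u → b τ u = 0) :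
    ∀ τ u, 0 ≤ u → (1 + u) ^ 4 * (a τ u ^ 2 + b τ u ^ 2) ≤ 4 * (16 * (2 + 13 / γ + γ / 13) ^ 2 / γ) ^ 2 * M ^ 2 := by
  have hM : 0 ≤ M := le_trans (by positivity) (hF₁ 0 1 one_pos)
  have hγ0 : γ ≠ 0 := hγ.ne'
  set κ : ℝ := 13 / γ with hκdef
  have hκ : 0 < κ := by positivity
  have hγκ : γ * κ = 13 := by rw [hκdef]; field_simp
  set K₀ : ℝ := 256 * M ^ 2 * (1 + κ) ^ 4 / γ ^ 2 with hK₀def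
  have hK₀ : 0 ≤ K₀ := by positivity
  -- the players (now functions of `(τ, u)`)
  set S : ℝ → ℝ → ℝ := fun τ t => a τ t ^ 2 + b τ t ^ 2 with hSdef
  set v : ℝ → ℝ → ℝ := fun τ t => S τ t * (t + κ) ^ 4 with hvdef
  set v₁ : ℝ → ℝ → ℝ := fun τ t => (2 * a τ t * a₁ τ t + 2 * b τ t * b₁ τ t) * (t + κ) ^ 4 + S τ t * (4 * (t + κ) ^ 3) with hv₁def
  set vτ : ℝ → ℝ → ℝ := fun τ t => (2 * (a τ t * aτ τ t + b τ t * bτ τ t)) * (t + κ) ^ 4 with hvτdef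
  set vττ : ℝ → ℝ → ℝ := fun τ t => (2 * (aτ τ t ^ 2 + a τ t * aττ τ t + bτ τ t ^ 2 + b τ t * bττ τ t)) * (t + κ) ^ 4 with hvττdef
  set Wr : ℝ → ℝ → ℝ := fun τ t => (t + κ) * ((a τ t * (4 * t * a₁ τ t + γ * t * a τ t) + b τ t * (4 * t * b₁ τ t + γ * t * b τ t)
      - γ * t * S τ t) / 2) + 4 * t * S τ t with hWrdef
  set P : ℝ → ℝ → ℝ := fun _ t => t / (t + κ) ^ 3 with hPdef
  -- pointwise data bounds
  have hF₁' : ∀ τ u, 0 < u → |F₁ τ u| ≤ M / (1 + u) ^ 2 := fun τ u hu => by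
    rw [le_div_iff₀ (by positivity)]; linarith [hF₁ τ u hu]
  have hF₂' : ∀ τ u, 0 < u → |F₂ τ u| ≤ M / (1 + u) ^ 2 := fun τ u hu => by
    rw [le_div_iff₀ (by positivity)]; linarith [hF₂ τ u hu]
  -- §A: for every `ε > 0`, the joint maximum principle gives `v ≤ 4K₀ + ε` on `ℝ × [0, U]`
  have hMP : ∀ ε : ℝ, 0 < ε → ∀ τ, ∀ u ∈ Icc 0 U, v τ u ≤ 4 * K₀ + ε := by
    intro ε hε
    refine maxPrinciple_axial_slow (v := v) (v_u := v₁) (v_τ := vτ) (v_ττ := vττ) (Wr := Wr) (P := P) (δ := γ * ε / 8)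
      (by positivity) ?_ ?_ ?_ ?_ ?_ ?_ ?_ ?_ ?_ ?_
    · -- joint continuity of `v`
      have hS : ContinuousOn (fun q : ℝ × ℝ => S q.1 q.2) (univ ×ˢ Icc 0 U) := by
        simp only [hSdef]
        exact (hca.pow 2).add (hcb.pow 2)
      have hk : ContinuousOn (fun q : ℝ × ℝ => (q.2 + κ) ^ 4) (univ ×ˢ Icc 0 U) :=
        ((continuous_snd.add continuous_const).pow 4).continuousOn
      simp only [hvdef]
      exact hS.mul hk
    · -- boundedness
      obtain ⟨B, hB⟩ := hbdd
      refine ⟨2 * B ^ 2 * (U + κ) ^ 4, fun τ u hu => ?_⟩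
      obtain ⟨h1, h2⟩ := hB τ u hu
      have hB0 : 0 ≤ B := le_trans (abs_nonneg _) h1
      have hS2 : S τ u ≤ 2 * B ^ 2 := by
        simp only [hSdef]
        have e1 : a τ u ^ 2 ≤ B ^ 2 := by
          rw [← sq_abs (a τ u)]; exact pow_le_pow_left₀ (abs_nonneg _) h1 2
        have e2 : b τ u ^ 2 ≤ B ^ 2 := by
          rw [← sq_abs (b τ u)]; exact pow_le_pow_left₀ (abs_nonneg _) h2 2
        linarith
      have hS0 : 0 ≤ S τ u := by simp only [hSdef]; positivity
      have hk4 : (u + κ) ^ 4 ≤ (U + κ) ^ 4 := pow_le_pow_left₀ (by linarith [hu.1]) (by linarith [hu.2]) 4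
      simp only [hvdef]
      calc S τ u * (u + κ) ^ 4 ≤ 2 * B ^ 2 * (u + κ) ^ 4 := mul_le_mul_of_nonneg_right hS2 (by positivity)
        _ ≤ 2 * B ^ 2 * (U + κ) ^ 4 := mul_le_mul_of_nonneg_left hk4 (by positivity)
    · -- derivative of `v` in `u`
      intro τ u hu
      have ha' := hdera τ u hu.1
      have hb' := hderb τ u hu.1
      have hS' : HasDerivAt (S τ) (2 * a τ u * a₁ τ u + 2 * b τ u * b₁ τ u) u := by
        have h1 : HasDerivAt (fun t => a τ t ^ 2) (2 * a τ u * a₁ τ u) u :=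
          (ha'.fun_pow 2).congr_deriv (by norm_num)
        have h2 : HasDerivAt (fun t => b τ t ^ 2) (2 * b τ u * b₁ τ u) u :=
          (hb'.fun_pow 2).congr_deriv (by norm_num)
        exact h1.add h2
      have hk : HasDerivAt (fun t : ℝ => (t + κ) ^ 4) (4 * (u + κ) ^ 3) u :=
        (((hasDerivAt_id' u).add_const κ).fun_pow 4).congr_deriv (by norm_num)
      exact hS'.mul hk
    · -- derivative of `v` in `τ`
      intro u hu τ
      have h1 : HasDerivAt (fun σ => a σ u ^ 2 + b σ u ^ 2) (2 * (a τ u * aτ τ u + b τ u * bτ τ u)) τ := by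
        have h := ((hdaτ u hu τ).pow 2).add ((hdbτ u hu τ).pow 2)
        refine h.congr_deriv ?_
        simp only [Nat.cast_ofNat]
        ring
      simp only [hvdef, hvτdef, hSdef]
      exact h1.mul_const _
    · -- second derivative of `v` in `τ`
      intro u hu τ
      have h2 : HasDerivAt (fun σ => 2 * (a σ u * aτ σ u + b σ u * bτ σ u))
          (2 * (aτ τ u ^ 2 + a τ u * aττ τ u + bτ τ u ^ 2 + b τ u * bττ τ u)) τ := by
        have h := (((hdaτ u hu τ).mul (hdaττ u hu τ)).add ((hdbτ u hu τ).mul (hdbττ u hu τ))).const_mul 2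
        refine h.congr_deriv ?_
        ring
      simp only [hvτdef, hvττdef]
      exact h2.mul_const _
    · -- `Wr = P · v₁`
      intro τ u hu
      have huκ : u + κ ≠ 0 := by linarith [hu.1]
      simp only [hWrdef, hPdef, hv₁def, hSdef]
      field_simp
      ring
    · -- `P > 0`
      intro τ u hu
      simp only [hPdef]
      have hu0 : 0 < u := hu.1
      have : 0 < u + κ := by linarith
      positivity
    · -- STRICT positivity of the flux derivative at penalised critical points above `4K₀ + ε`
      intro τ u hu hvK hv₁0 hτvτ _ _ hvττ
      have hu0 : 0 < u := hu.1
      have hu0' : u ≠ 0 := hu0.ne'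
      have huκ : 0 < u + κ := by linarith
      have huκ' : u + κ ≠ 0 := huκ.ne'
      have huκ4 : 0 < (u + κ) ^ 4 := by positivity
      have ha' := hdera τ u hu0
      have hb' := hderb τ u hu0
      -- the effective data (true data minus the axial terms)
      set f1 : ℝ := F₁ τ u - (κ' * τ * aτ τ u - aττ τ u) with hf1def
      set f2 : ℝ := F₂ τ u - (κ' * τ * bτ τ u - bττ τ u) with hf2def
      have hA : HasDerivAt (fun s => 4 * s * a₁ τ s + γ * s * a τ s) (m ^ 2 / u * a τ u - V τ u * b τ u - f1) u :=
        (hΦa τ u hu0).congr_deriv (by rw [hf1def]; ring)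
      have hB : HasDerivAt (fun s => 4 * s * b₁ τ s + γ * s * b τ s) (m ^ 2 / u * b τ u + V τ u * a τ u - f2) u :=
        (hΦb τ u hu0).congr_deriv (by rw [hf2def]; ring)
      -- derivative of `S(τ, ·)`
      have hS' : HasDerivAt (S τ) (2 * a τ u * a₁ τ u + 2 * b τ u * b₁ τ u) u := by
        have h1 : HasDerivAt (fun t => a τ t ^ 2) (2 * a τ u * a₁ τ u) u :=
          (ha'.fun_pow 2).congr_deriv (by norm_num)
        have h2 : HasDerivAt (fun t => b τ t ^ 2) (2 * b τ u * b₁ τ u) u :=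
          (hb'.fun_pow 2).congr_deriv (by norm_num)
        exact h1.add h2
      -- derivative of the inner bracket
      have hG : HasDerivAt (fun t => (a τ t * (4 * t * a₁ τ t + γ * t * a τ t) + b τ t * (4 * t * b₁ τ t + γ * t * b τ t)
          - γ * t * S τ t) / 2)
          ((a₁ τ u * (4 * u * a₁ τ u + γ * u * a τ u) + a τ u * (m ^ 2 / u * a τ u - V τ u * b τ u - f1)
            + (b₁ τ u * (4 * u * b₁ τ u + γ * u * b τ u) + b τ u * (m ^ 2 / u * b τ u + V τ u * a τ u - f2))
            - (γ * S τ u + γ * u * (2 * a τ u * a₁ τ u + 2 * b τ u * b₁ τ u))) / 2) u := by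
        have h1 := ha'.mul hA
        have h2 := hb'.mul hB
        have h3 : HasDerivAt (fun t => γ * t * S τ t) (γ * S τ u + γ * u * (2 * a τ u * a₁ τ u + 2 * b τ u * b₁ τ u)) u := by
          have hγt : HasDerivAt (fun t : ℝ => γ * t) γ u := by
            simpa using (hasDerivAt_id' u).const_mul γ
          exact hγt.mul hS'
        exact ((h1.add h2).sub h3).div_const 2
      have h1κ : HasDerivAt (fun t : ℝ => t + κ) 1 u := (hasDerivAt_id' u).add_const κ
      have h4t : HasDerivAt (fun t : ℝ => 4 * t) 4 u := by simpa using (hasDerivAt_id' u).const_mul (4:ℝ)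
      have hWrD := (h1κ.mul hG).add (h4t.mul hS')
      set G : ℝ := (a τ u * (4 * u * a₁ τ u + γ * u * a τ u) + b τ u * (4 * u * b₁ τ u + γ * u * b τ u) - γ * u * S τ u) / 2
        with hGdef
      set G' : ℝ := ((a₁ τ u * (4 * u * a₁ τ u + γ * u * a τ u) + a τ u * (m ^ 2 / u * a τ u - V τ u * b τ u - f1)
            + (b₁ τ u * (4 * u * b₁ τ u + γ * u * b τ u) + b τ u * (m ^ 2 / u * b τ u + V τ u * a τ u - f2))
            - (γ * S τ u + γ * u * (2 * a τ u * a₁ τ u + 2 * b τ u * b₁ τ u))) / 2) with hG'def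
      set D : ℝ := 1 * G + (u + κ) * G' + (4 * S τ u + 4 * u * (2 * a τ u * a₁ τ u + 2 * b τ u * b₁ τ u)) with hDdef
      have hWrD' : HasDerivAt (Wr τ) D u := by
        have e : Wr τ = fun t => (t + κ) * ((a τ t * (4 * t * a₁ τ t + γ * t * a τ t) + b τ t * (4 * t * b₁ τ t + γ * t * b τ t)
            - γ * t * S τ t) / 2) + 4 * t * S τ t := by
          funext t; simp only [hWrdef]
        rw [e]; exact hWrD
      refine ⟨D, ?_, hWrD'⟩
      -- `Wr = 0` at the critical point
      have hWr0 : Wr τ u = 0 := by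
        have e1 : Wr τ u = P τ u * v₁ τ u := by
          simp only [hWrdef, hPdef, hv₁def, hSdef]
          field_simp
          ring
        rw [e1, hv₁0, mul_zero]
      have hWr0' : (u + κ) * G + 4 * u * S τ u = 0 := by
        have : Wr τ u = (u + κ) * G + 4 * u * S τ u := by simp only [hWrdef, hGdef]
        rw [← this]; exact hWr0
      -- the key algebraic identity
      set poly : ℝ := m ^ 2 * (u + κ) ^ 2 + γ * u ^ 3 - 32 * u ^ 2 + κ * (8 - γ * κ) * u with hpolydef
      have hDid : D = 2 * u * (u + κ) * (a₁ τ u ^ 2 + b₁ τ u ^ 2) + S τ u * (poly / (2 * u * (u + κ)))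
          - (u + κ) * (a τ u * f1 + b τ u * f2) / 2
          + (5 - γ * (u + κ) / 4) / (u + κ) * ((u + κ) * G + 4 * u * S τ u) := by
        simp only [hDdef, hGdef, hG'def, hpolydef, hSdef]
        field_simp
        ring
      rw [hWr0', mul_zero, add_zero] at hDid
      -- the symbol lower bound
      have hpoly : γ * u * (u + κ) ^ 2 / 8 ≤ poly := by
        have := azimuthalBlock_symbol_lower (m := m) hγ hm hu0.le
        simp only [hpolydef, hκdef] at this ⊢
        exact this
      have hBr : γ * (u + κ) / 16 ≤ poly / (2 * u * (u + κ)) := by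
        rw [le_div_iff₀ (by positivity)]
        have : γ * (u + κ) / 16 * (2 * u * (u + κ)) = γ * u * (u + κ) ^ 2 / 8 := by ring
        linarith [this, hpoly]
      have hS0 : 0 ≤ S τ u := by simp only [hSdef]; positivity
      -- from the threshold: `S > 4 t²` and `v > ε`
      have hvK' : 4 * K₀ + ε < S τ u * (u + κ) ^ 4 := by simpa [hvdef] using hvK
      have hvε : ε < S τ u * (u + κ) ^ 4 := by linarith
      have hSbig : 4 * (256 * M ^ 2 / (γ ^ 2 * (1 + u) ^ 4)) < S τ u := by
        have hcmp : (u + κ) ^ 4 ≤ (1 + κ) ^ 4 * (1 + u) ^ 4 := by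
          rw [← mul_pow]
          apply pow_le_pow_left₀ huκ.le
          have : u + κ ≤ (1 + κ) * (1 + u) := by nlinarith only [hu0.le, hκ.le]
          exact this
        have h1 : 4 * (256 * M ^ 2 * (1 + κ) ^ 4 / γ ^ 2) < S τ u * ((1 + κ) ^ 4 * (1 + u) ^ 4) := by
          calc 4 * (256 * M ^ 2 * (1 + κ) ^ 4 / γ ^ 2) = 4 * K₀ := by rw [hK₀def]
            _ < S τ u * (u + κ) ^ 4 := by linarith
            _ ≤ S τ u * ((1 + κ) ^ 4 * (1 + u) ^ 4) := mul_le_mul_of_nonneg_left hcmp hS0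
        have hγ2 : 0 < γ ^ 2 := by positivity
        have hk4 : 0 < (1 + κ) ^ 4 := by positivity
        have hu4 : 0 < (1 + u) ^ 4 := by positivity
        have h2 : 4 * (256 * M ^ 2 * (1 + κ) ^ 4) < S τ u * ((1 + κ) ^ 4 * (1 + u) ^ 4) * γ ^ 2 := by
          have h1m := mul_lt_mul_of_pos_right h1 hγ2
          have e1 : 4 * (256 * M ^ 2 * (1 + κ) ^ 4 / γ ^ 2) * γ ^ 2 = 4 * (256 * M ^ 2 * (1 + κ) ^ 4) := by
            field_simp
          linarith [h1m, e1]
        have h3 : (4 * (256 * M ^ 2)) * (1 + κ) ^ 4 < (S τ u * (γ ^ 2 * (1 + u) ^ 4)) * (1 + κ) ^ 4 := by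
          have e1 : (4 * (256 * M ^ 2)) * (1 + κ) ^ 4 = 4 * (256 * M ^ 2 * (1 + κ) ^ 4) := by ring
          have e2 : (S τ u * (γ ^ 2 * (1 + u) ^ 4)) * (1 + κ) ^ 4 = S τ u * ((1 + κ) ^ 4 * (1 + u) ^ 4) * γ ^ 2 := by ring
          rw [e1, e2]; exact h2
        have h4 : 4 * (256 * M ^ 2) < S τ u * (γ ^ 2 * (1 + u) ^ 4) := lt_of_mul_lt_mul_right h3 hk4.le
        rw [mul_div_assoc', div_lt_iff₀ (by positivity)]
        exact h4
      set t : ℝ := 16 * M / (γ * (1 + u) ^ 2) with htdef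
      have ht0 : 0 ≤ t := by positivity
      have ht2 : t ^ 2 = 256 * M ^ 2 / (γ ^ 2 * (1 + u) ^ 4) := by
        rw [htdef, div_pow]; congr 1 <;> ring
      have hSt : 4 * t ^ 2 < S τ u := by rw [ht2]; exact hSbig
      have hSpos : 0 < S τ u := lt_of_le_of_lt (by positivity) hSt
      have hab : (|a τ u| + |b τ u|) ^ 2 ≤ 2 * S τ u := by
        have h2ab : 2 * |a τ u| * |b τ u| ≤ |a τ u| ^ 2 + |b τ u| ^ 2 := two_mul_le_add_sq _ _
        have e : (|a τ u| + |b τ u|) ^ 2 = |a τ u| ^ 2 + |b τ u| ^ 2 + 2 * |a τ u| * |b τ u| := by ring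
        have eS : S τ u = |a τ u| ^ 2 + |b τ u| ^ 2 := by simp only [hSdef, sq_abs]
        rw [e, eS]; linarith
      have hdom : (|a τ u| + |b τ u|) * t < S τ u := by
        have hsq : ((|a τ u| + |b τ u|) * t) ^ 2 < (S τ u) ^ 2 := by
          have e : ((|a τ u| + |b τ u|) * t) ^ 2 = (|a τ u| + |b τ u|) ^ 2 * t ^ 2 := by ring
          rw [e]
          have h2 : (|a τ u| + |b τ u|) ^ 2 * t ^ 2 ≤ 2 * S τ u * t ^ 2 :=
            mul_le_mul_of_nonneg_right hab (sq_nonneg t)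
          have ht4 : t ^ 2 < S τ u / 4 := by linarith
          have h3 : 2 * S τ u * t ^ 2 < 2 * S τ u * (S τ u / 4) := mul_lt_mul_of_pos_left ht4 (by linarith)
          have h4 : 2 * S τ u * (S τ u / 4) ≤ S τ u ^ 2 := by nlinarith only [hSpos]
          linarith
        exact lt_of_pow_lt_pow_left₀ 2 hS0 hsq
      -- the TRUE data are dominated (with room: `γ(u+κ)/32`)
      have hdataF : (u + κ) * (a τ u * F₁ τ u + b τ u * F₂ τ u) / 2 < S τ u * (γ * (u + κ) / 32) := by
        have h1 : a τ u * F₁ τ u + b τ u * F₂ τ u ≤ (|a τ u| + |b τ u|) * (M / (1 + u) ^ 2) := by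
          have e1 : a τ u * F₁ τ u ≤ |a τ u| * |F₁ τ u| := by rw [← abs_mul]; exact le_abs_self _
          have e2 : b τ u * F₂ τ u ≤ |b τ u| * |F₂ τ u| := by rw [← abs_mul]; exact le_abs_self _
          have e3 : |a τ u| * |F₁ τ u| ≤ |a τ u| * (M / (1 + u) ^ 2) :=
            mul_le_mul_of_nonneg_left (hF₁' τ u hu0) (abs_nonneg _)
          have e4 : |b τ u| * |F₂ τ u| ≤ |b τ u| * (M / (1 + u) ^ 2) :=
            mul_le_mul_of_nonneg_left (hF₂' τ u hu0) (abs_nonneg _)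
          linarith
        have h2 : (|a τ u| + |b τ u|) * (M / (1 + u) ^ 2) = (|a τ u| + |b τ u|) * t * (γ / 16) := by
          rw [htdef]; field_simp
        have h3 : (|a τ u| + |b τ u|) * t * (γ / 16) < S τ u * (γ / 16) :=
          mul_lt_mul_of_pos_right hdom (by positivity)
        have h4 : (u + κ) * (a τ u * F₁ τ u + b τ u * F₂ τ u) / 2 ≤ (u + κ) * ((|a τ u| + |b τ u|) * t * (γ / 16)) / 2 := by
          have := mul_le_mul_of_nonneg_left (h1.trans_eq h2) huκ.le
          linarith
        have h5 : (u + κ) * ((|a τ u| + |b τ u|) * t * (γ / 16)) / 2 < (u + κ) * (S τ u * (γ / 16)) / 2 := by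
          have := mul_lt_mul_of_pos_left h3 huκ
          linarith
        have h6 : (u + κ) * (S τ u * (γ / 16)) / 2 = S τ u * (γ * (u + κ) / 32) := by ring
        linarith
      -- the AXIAL terms at the penalised critical point: `−[a(κ'τaτ − aττ) + b(κ'τbτ − bττ)] ≤ δ/(2(u+κ)⁴)`
      have haxial : -(γ * ε / 8 / (u + κ) ^ 4 / 2)
          ≤ a τ u * (κ' * τ * aτ τ u - aττ τ u) + b τ u * (κ' * τ * bτ τ u - bττ τ u) := by
        have hτs : 0 ≤ τ * (2 * (a τ u * aτ τ u + b τ u * bτ τ u)) := by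
          have e : τ * vτ τ u = τ * (2 * (a τ u * aτ τ u + b τ u * bτ τ u)) * (u + κ) ^ 4 := by
            simp only [hvτdef]; ring
          rw [e] at hτvτ
          exact (mul_nonneg_iff_of_pos_right huκ4).mp hτvτ
        have hs₂ : 2 * (aτ τ u ^ 2 + a τ u * aττ τ u + bτ τ u ^ 2 + b τ u * bττ τ u) ≤ γ * ε / 8 / (u + κ) ^ 4 := by
          rw [le_div_iff₀ huκ4]
          simpa [hvττdef] using hvττ
        have e : a τ u * (κ' * τ * aτ τ u - aττ τ u) + b τ u * (κ' * τ * bτ τ u - bττ τ u)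
            = (κ' * (τ * (2 * (a τ u * aτ τ u + b τ u * bτ τ u)))
                - 2 * (aτ τ u ^ 2 + a τ u * aττ τ u + bτ τ u ^ 2 + b τ u * bττ τ u)) / 2
              + (aτ τ u ^ 2 + bτ τ u ^ 2) := by ring
        rw [e]
        have h1 : 0 ≤ κ' * (τ * (2 * (a τ u * aτ τ u + b τ u * bτ τ u))) := mul_nonneg hκ' hτs
        have h2 : 0 ≤ aτ τ u ^ 2 + bτ τ u ^ 2 := by positivity
        linarith
      -- total data term
      have hdata : (u + κ) * (a τ u * f1 + b τ u * f2) / 2 < S τ u * (γ * (u + κ) / 16) := by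
        have e : a τ u * f1 + b τ u * f2 = (a τ u * F₁ τ u + b τ u * F₂ τ u)
            - (a τ u * (κ' * τ * aτ τ u - aττ τ u) + b τ u * (κ' * τ * bτ τ u - bττ τ u)) := by
          rw [hf1def, hf2def]; ring
        have h1 : (u + κ) * (a τ u * f1 + b τ u * f2) / 2
            ≤ (u + κ) * (a τ u * F₁ τ u + b τ u * F₂ τ u) / 2 + (u + κ) * (γ * ε / 8 / (u + κ) ^ 4 / 2) / 2 := by
          rw [e]
          have := mul_le_mul_of_nonneg_left haxial huκ.le
          linarith
        have h2 : (u + κ) * (γ * ε / 8 / (u + κ) ^ 4 / 2) / 2 ≤ S τ u * (γ * (u + κ) / 32) := by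
          -- `ε ≤ S (u+κ)⁴`
          have h3 : γ * ε ≤ γ * (S τ u * (u + κ) ^ 4) := mul_le_mul_of_nonneg_left hvε.le hγ.le
          have h32 : (0:ℝ) < 32 * (u + κ) ^ 3 := by positivity
          have e2 : (u + κ) * (γ * ε / 8 / (u + κ) ^ 4 / 2) / 2 = γ * ε / (32 * (u + κ) ^ 3) := by
            rw [eq_div_iff h32.ne']
            field_simp
            norm_num
          have e3 : S τ u * (γ * (u + κ) / 32) = γ * (S τ u * (u + κ) ^ 4) / (32 * (u + κ) ^ 3) := by
            rw [eq_div_iff h32.ne']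
            ring
          rw [e2, e3]
          exact div_le_div_of_nonneg_right h3 h32.le
        linarith
      -- conclusion
      have hder2 : 0 ≤ 2 * u * (u + κ) * (a₁ τ u ^ 2 + b₁ τ u ^ 2) := by positivity
      have hmain : S τ u * (γ * (u + κ) / 16) ≤ S τ u * (poly / (2 * u * (u + κ))) :=
        mul_le_mul_of_nonneg_left hBr hS0
      rw [hDid]
      linarith
    · -- `v(τ, 0) ≤ K`
      intro τ
      simp only [hvdef, hSdef, ha0 τ, hb0 τ]
      have : 0 ≤ 4 * K₀ + ε := by positivity
      simpa using this
    · -- `v(τ, U) ≤ K`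
      intro τ
      simp only [hvdef, hSdef, hsuppa τ U le_rfl, hsuppb τ U le_rfl]
      have : 0 ≤ 4 * K₀ + ε := by positivity
      simpa using this
  -- §B: `ε ↓ 0` and the passage to the `(1+u)⁴` weight
  intro τ u hu
  have hS0 : 0 ≤ a τ u ^ 2 + b τ u ^ 2 := by positivity
  have huκ : 0 < u + κ := by linarith
  have hvle : (a τ u ^ 2 + b τ u ^ 2) * (u + κ) ^ 4 ≤ 4 * K₀ := by
    rcases le_or_gt u U with h | h
    · refine le_of_forall_pos_le_add fun ε hε => ?_
      have := hMP ε hε τ u ⟨hu, h⟩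
      simpa [hvdef, hSdef] using this
    · rw [hsuppa τ u h.le, hsuppb τ u h.le]
      simpa using hK₀
  have hcmp : (1 + u) ^ 4 ≤ ((1 + 1 / κ) * (u + κ)) ^ 4 := by
    apply pow_le_pow_left₀ (by linarith)
    have : (1 + 1 / κ) * (u + κ) = 1 + u + κ + u / κ := by field_simp; ring
    rw [this]
    have : 0 ≤ u / κ := by positivity
    linarith
  have hfin : (1 + u) ^ 4 * (a τ u ^ 2 + b τ u ^ 2) ≤ (1 + 1 / κ) ^ 4 * (4 * K₀) := by
    calc (1 + u) ^ 4 * (a τ u ^ 2 + b τ u ^ 2)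
        ≤ ((1 + 1 / κ) * (u + κ)) ^ 4 * (a τ u ^ 2 + b τ u ^ 2) := mul_le_mul_of_nonneg_right hcmp hS0
      _ = (1 + 1 / κ) ^ 4 * ((a τ u ^ 2 + b τ u ^ 2) * (u + κ) ^ 4) := by ring
      _ ≤ (1 + 1 / κ) ^ 4 * (4 * K₀) := mul_le_mul_of_nonneg_left hvle (by positivity)
  have hconst : (1 + 1 / κ) ^ 4 * (4 * K₀) = 4 * (16 * (2 + 13 / γ + γ / 13) ^ 2 / γ) ^ 2 * M ^ 2 := by
    rw [hK₀def, hκdef]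
    field_simp
    ring
  linarith [hfin, hconst]

end Summit.NavierStokesRegularity.NavierStokesRegularity.Theorems.DefectColumnGate

end
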